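import Summits.ResolutionOfSingularities.ResolutionOfSingularities.Theorems.WeightDescentClasses
import Summits.ResolutionOfSingularities.ResolutionOfSingularities.Theorems.AbsoluteContactPrimitives
import Literature.AlgebraicGeometry.Resolution.DifferentialOperators
import HarnessLib

/-!
# FactorContactClasses — decomp-res node «FactorContact» (lens-4 g17; CRITIC-LEDGER row 114 CLEARED:
DECIDED-MOD-PORT +1 cell (L,P,drift,tame), located residual (L,P,drift,bi-wild))
refining the MaxContactCut aside 32260 (host of the lens-4 column).  Tree file 1/3 of the node.

Content VERBATIM from the decomp-res lens-4 cumulative file `HOME/decomp-res-lens-4/g18/CouplingCut.lean` (sha256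
5bf7b2ca8f7311e8;
its §1–§6 = g14 HugValuationCut, ALREADY in the tree as `Theorems/HugValuationCut{Chains,Classes,Kernels}` +
`MaxContactCutHugValuationCut`; §7–§12 = g15 «MarkingBudget» @369c12ac; §13–§17 = g16 «WeightDescent»
@1cb1c32f; §18–§23 = g17
«FactorContact» @daf245ab; §24–§31 = g18 «CouplingCut»).  HOME = run/shared/lean/pub/decomp-res.

Route-independent, cone-free: §18 FACTOR TAMENESS — absolute differential contact of the two FACTORS of the hug,
each at its own marking
(`IsAbsContactIdealAt` for any stalk ideal; the point primitive `IsAbsContactAt` is lens-6's, tree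
`AbsoluteContactPrimitives`, OPENED not
restated — `isAbsContactAt_iff` is `Iff.rfl`; `HugShadow.cofactorIdeal`, `StableFrom`, `TopTameAt` / `TailTameAt`,
`FactorTame` / `BiWild` +
PROVED kernels `BiWild.cofactor_mem_sq`, `BiWild.germ_mem_sq`, `tailTameAt_of_linear_member`); §19 the CELLS (L,P,drift,tame)
`TameDriftingTowersTerminate` [DECIDED-MOD-PORT `FactorContactPort`], (L,P,drift,wild) `WildDriftingTowersTerminate`
[LOCATED RESIDUAL of g17],
tame/wild impure slabs; §20 the factor contact port (COSTUME(cite): tree Giraud lemma over `ℤ`); §22 the all-weights classes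
`NoWildDriftingTowers`, `NoTameDriftingTowers`.  Kernels (§21, §23 shallow/deep cut): `FactorContactKernels`;
wiring: `MaxContactCutFactorContact`.

[WRITER NOTE (decomp-res writer g6): the whole lens-4 chain lives in ONE namespace `…Theorems.HugValuationCut` (the tree's g14
namespace) so that the lens's `HugChain.`/`HugShadow.`/`MarkedShadow.` dot-notation extends the landed structures
verbatim; the lens's
`noTower_iff_perfect_and_imperfect` is the tree's `ContactShadowKernels.noTower_iff_columns`; `set_option` lines
dropped; cone-free
(no `Theses` import) so the route file can import it for asides; the BY-NAME wiring to the MaxContactCut items is in the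
`MaxContactCut<Node>` companion files.]
(Sources: CossartJannsenSaito2020 Key Thm. 6.40, Cor. 6.37, Lem. 6.35/6.36; BierstoneGrigorievMilmanWlodarczyk2011
§3 (marked ideals, Lem. 3.2.1, §3.7); CossartPiltant2019; Abhyankar1956; Cutkosky2009 §2.1; Giraud1975
(Diff-lemma); EGAIV4 §16.8.)
-/

noncomputable section

open CategoryTheory AlgebraicGeometry IsLocalRing
open Literature.AlgebraicGeometry.Resolution
open Summit.ResolutionOfSingularities.ResolutionOfSingularities.Theorems
open WeakOrderReduction ForcedTowerClasses DivergentTowerClasses MonomialTowerClasses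
open HugDimensionClasses HugDimensionKernels SurfaceShadowClasses SurfaceShadowKernels
open ContactShadowClasses (NoTowerImperfect)
open ContactShadowKernels (noTowerImperfect_of_noTower noTowerImperfect_mono noTower_iff_columns)
open NearPointCut (SingularClass singularSurface_iff_noTower)
open AbsoluteContactClasses (IsAbsContactAt)

namespace Summit.ResolutionOfSingularities.ResolutionOfSingularities.Theorems.HugValuationCut

variable {K : Type} [Field K]

/-! ## §18 (g17 · NEW) FACTOR TAMENESS — absolute differential contact of the two FACTORS of the hug, each at its OWN
marking (the typed cofactor `J_j = (I_j : 𝓘(Σ_j))`; the contact primitive is lens-6 g15's `IsAbsContactAt`, restated) -/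

/-- **ABSOLUTE CONTACT OF A STALK IDEAL `𝔞 ⊆ 𝒪_{Y,y}` AT MARKING `μ`**: some element of `Diff^{≤
μ−1}_ℤ(𝔞)` — the tree's
`diffIdeal` over the base ring `ℤ` (Grothendieck operators of `𝒪_{Y,y}` linear over the prime ring only, EGA IV 16.8),
which CONTAINS every `Diff^{≤ μ−1}_k(𝔞)` — lies in `𝔪_y ∖ 𝔪_y²`: its zero locus is a REGULAR
HYPERSURFACE GERM having
maximal contact with `(𝔞, μ)`.  No field, no structure map, any ideal of the stalk (not only stalks of ideal sheaves). -/
def IsAbsContactIdealAt {Y : Scheme.{0}} {y : Y} (𝔞 : Ideal (Y.presheaf.stalk y)) (μ : ℕ) : Prop :=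
  ∃ u ∈ diffIdeal ℤ (μ - 1) 𝔞,
    u ∈ IsLocalRing.maximalIdeal (Y.presheaf.stalk y) ∧ u ∉ IsLocalRing.maximalIdeal (Y.presheaf.stalk y) ^ 2

/-- the two primitives agree on stalks of ideal sheaves (definitional). [folklore] -/
theorem isAbsContactAt_iff {Y : Scheme.{0}} (I : Y.IdealSheafData) (n : ℕ) (y : Y) :
    IsAbsContactAt I n y ↔ IsAbsContactIdealAt (stalkIdeal I y) n :=
  Iff.rfl

/-- **contact is MONOTONE in the ideal and in the marking** (`Diff^{≤ a}(𝔞) ⊆ Diff^{≤ b}(𝔟)` for `𝔞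
⊆ 𝔟`, `a ≤ b`).
[folklore] -/
theorem IsAbsContactIdealAt.mono {Y : Scheme.{0}} {y : Y} {𝔞 𝔟 : Ideal (Y.presheaf.stalk y)} {μ μ' : ℕ}
    (h : IsAbsContactIdealAt 𝔞 μ) (hle : 𝔞 ≤ 𝔟) (hμ : μ ≤ μ') : IsAbsContactIdealAt 𝔟 μ' := by
  obtain ⟨u, hu, h1, h2⟩ := h
  exact ⟨u, diffIdeal_mono ℤ (μ' - 1) hle (diffIdeal_mono_left ℤ (Nat.sub_le_sub_right hμ 1) 𝔞 hu), h1, h2⟩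

/-- **COFACTOR CONTACT (PROVED, the elementary law of the node): an element of `𝔞` of order EXACTLY ONE is an absolute
contact witness for `(𝔞, μ)` at EVERY marking `μ`** (the identity is a differential operator of order `0 ≤ μ − 1`,
tree `le_diffIdeal`).  In the tower: a cofactor `J_j` of order `n − ν_j = 1` containing a regular parameter `h` makes the
tower hug the regular surface `V(h)` (port (T1)–(T5) with `D = id`). [folklore] -/
theorem isAbsContactIdealAt_of_mem {Y : Scheme.{0}} {y : Y} {𝔞 : Ideal (Y.presheaf.stalk y)} (μ : ℕ)
    {h : Y.presheaf.stalk y} (hh : h ∈ 𝔞) (h1 : h ∈ IsLocalRing.maximalIdeal (Y.presheaf.stalk y))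
    (h2 : h ∉ IsLocalRing.maximalIdeal (Y.presheaf.stalk y) ^ 2) : IsAbsContactIdealAt 𝔞 μ :=
  ⟨h, le_diffIdeal ℤ (μ - 1) 𝔞 hh, h1, h2⟩

/-- **NO CONTACT ⇒ NO LINEAR MEMBER (PROVED)**: if `(𝔞, μ)` has no absolute contact witness, every member of `𝔞`
vanishing at `y` vanishes to order `≥ 2` — a WILD factor is a SINGULAR factor. [folklore] -/
theorem mem_sq_of_not_isAbsContactIdealAt {Y : Scheme.{0}} {y : Y} {𝔞 : Ideal (Y.presheaf.stalk y)} {μ : ℕ}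
    (h : ¬ IsAbsContactIdealAt 𝔞 μ) {f : Y.presheaf.stalk y} (hf : f ∈ 𝔞)
    (h1 : f ∈ IsLocalRing.maximalIdeal (Y.presheaf.stalk y)) :
    f ∈ IsLocalRing.maximalIdeal (Y.presheaf.stalk y) ^ 2 := by
  by_contra h2
  exact h (isAbsContactIdealAt_of_mem μ hf h1 h2)

/-- **VACUITY ANCHOR (PROVED): on the UNIT ideal the contact predicate only says `𝔪_y ⊄ 𝔪_y²`** (`Diff^{≤
a}(⊤) = ⊤`,
tree `diffIdeal_top`) — at a PURE stage the cofactor is the unit ideal and «tail contact» is content-free, which is why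
the port's tail clause carries `¬ Pure`. [folklore] -/
theorem isAbsContactIdealAt_top_iff {Y : Scheme.{0}} {y : Y} (μ : ℕ) :
    IsAbsContactIdealAt (⊤ : Ideal (Y.presheaf.stalk y)) μ ↔
      ∃ u ∈ IsLocalRing.maximalIdeal (Y.presheaf.stalk y), u ∉ IsLocalRing.maximalIdeal (Y.presheaf.stalk y) ^ 2 := by
  constructor
  · rintro ⟨u, -, h1, h2⟩
    exact ⟨u, h1, h2⟩
  · rintro ⟨u, h1, h2⟩
    exact ⟨u, by rw [diffIdeal_top ℤ (μ - 1)]; exact Submodule.mem_top, h1, h2⟩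

namespace HugShadow

variable {T : ForcedTower} (S : HugShadow T)

/-- **THE COFACTOR `J_j := (I_{m+j} : 𝓘(Σ_j))` at the marked point** — the colon of the stalk of the marking by the stalk
of the `j`-th strict transform of the hugged germ.  On an in-locus PRINCIPAL shadow (`𝓘(Σ_j)_{x_j} = (g_j)`,
`I_j ⊆ (g_j)`,
the stalk a regular local DOMAIN) this is THE cofactor: `I_j = g_j · J_j`, `ord_{x_j} J_j = n − ν_j` ((D1)–(D2)), and the
cofactors transform as the marked ideal `(J_j, n − ν)` ((D3): `J_{j+1} = (J_j 𝒪_{x_{j+1}} : u_j^{n−ν})`).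
CANONICAL: no
choice of generator, no cofactor datum (critic row 108 r4: the cofactor is TYPED before any engine is invoked). -/
def cofactorIdeal (j : ℕ) : Ideal ((T.St (S.m + j)).presheaf.stalk (T.pt (S.m + j))) :=
  Submodule.colon (stalkIdeal (T.D (S.m + j)).ideal (T.pt (S.m + j)))
    ((stalkIdeal (strictIter T S.m S.germ j) (T.pt (S.m + j)) : Ideal _) : Set _)

/-- **STABLE FROM STAGE `j` AT VALUE `ν`**: `ν_i = ν` for all `i ≥ j` (port-level (D1)(b): `ν_i` is non-increasing and
`≥ 1`, so EVERY shadow is stable from some stage at some value; in the singular class `ν ≥ 2`, in-locus `ν ≤ n`). -/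
def StableFrom (j ν : ℕ) : Prop :=
  ∀ i, j ≤ i → S.topOrder i = ν

/-- **TOP-TAME at stage `j`, value `ν`**: the hugged hypersurface `(𝓘(Σ_j), ν)` has an ABSOLUTE CONTACT WITNESS at the
marked point — some `z ∈ Diff^{≤ ν−1}_ℤ((g_j))` of order exactly `1` (over a perfect field at a
Hasse–Schmidt point:
the initial form `in_{x_j} g_j ∈ κ[gr¹]` is NOT a polynomial in `p`-th powers; automatic when `p ∤ ν`, (R1)). -/
def TopTameAt (j ν : ℕ) : Prop :=
  IsAbsContactAt (strictIter T S.m S.germ j) ν (T.pt (S.m + j))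

/-- **TAIL-TAME at stage `j`, value `ν`, weight `n`**: the COFACTOR `(J_j, n − ν)` has an absolute contact witness at the
marked point (automatic when `n − ν = 1`: `isAbsContactIdealAt_of_mem`; over a perfect field automatic when
`p ∤ n − ν`, (R1)). -/
def TailTameAt (n j ν : ℕ) : Prop :=
  IsAbsContactIdealAt (S.cofactorIdeal j) (n - ν)

/-- **FACTOR-TAME at weight `n`**: at SOME stage from which the top order is stable, ONE of the two factors of the hug —
the hugged hypersurface `(𝓘(Σ_j), ν)` or the cofactor `(J_j, n − ν)` — has an absolute contact witness. -/
def FactorTame (n : ℕ) : Prop :=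
  ∃ j ν : ℕ, S.StableFrom j ν ∧ (S.TopTameAt j ν ∨ S.TailTameAt n j ν)

/-- **BI-WILD at weight `n` = THE LOCATED RESIDUAL's shadow predicate**: at EVERY stable stage BOTH factors are
contact-free for absolute differential operators — `Diff^{≤ ν−1}_ℤ((g_j)) ⊆ 𝔪²_{x_j} + (non-parameters)` and
`Diff^{≤ n−ν−1}_ℤ(J_j)` likewise: no regular hypersurface germ has maximal contact with EITHER factor, ever
(normal form (N′) of the module docstring: `p ∣ ν`, `p ∣ n − ν`, `n ≥ 2p`, both initial forms Frobenius forms). -/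
def BiWild (n : ℕ) : Prop :=
  ¬ S.FactorTame n

/-- pure logic. [folklore] -/
theorem biWild_iff (n : ℕ) :
    S.BiWild n ↔ ∀ j ν : ℕ, S.StableFrom j ν → ¬ S.TopTameAt j ν ∧ ¬ S.TailTameAt n j ν := by
  simp only [BiWild, FactorTame, not_exists, not_and, not_or]

/-- excluded middle on the tameness axis. [folklore] -/
theorem factorTame_or_biWild (n : ℕ) : S.FactorTame n ∨ S.BiWild n :=
  Classical.em _

/-- stability is inherited by later stages. [folklore] -/
theorem StableFrom.of_le {S : HugShadow T} {j j' ν : ℕ} (h : S.StableFrom j ν) (hj : j ≤ j') : S.StableFrom j' ν :=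
  fun i hi => h i (hj.trans hi)

/-- the stable value of an IMPURE shadow is not the weight (so, port-level (D1)(c), it is `< n`). [folklore] -/
theorem StableFrom.ne_of_not_pure {S : HugShadow T} {n j ν : ℕ} (h : S.StableFrom j ν) (hnp : ¬ S.Pure n) : ν ≠ n := by
  rintro rfl
  exact hnp ⟨j, h⟩

/-- a stable shadow at the weight itself is pure. [folklore] -/
theorem StableFrom.pure {S : HugShadow T} {n j : ℕ} (h : S.StableFrom j n) : S.Pure n :=
  ⟨j, h⟩

/-- **IN THE BI-WILD CLASS BOTH FACTORS ARE SINGULAR AT EVERY STABLE STAGE (PROVED, port-free)**: every member of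
the cofactor `J_j` vanishing at the marked point vanishes to order `≥ 2` (so, with (D2) `ord J_j = n − ν` and `J_j`
proper, `n − ν ≥ 2`: A BI-WILD DRIFTING TOWER HAS WEIGHT `n = ν + (n − ν) ≥ 4`), and likewise for
`(g_j)`. [folklore] -/
theorem BiWild.cofactor_mem_sq {S : HugShadow T} {n : ℕ} (h : S.BiWild n) {j ν : ℕ} (hs : S.StableFrom j ν)
    {f : (T.St (S.m + j)).presheaf.stalk (T.pt (S.m + j))} (hf : f ∈ S.cofactorIdeal j)
    (h1 : f ∈ IsLocalRing.maximalIdeal _) : f ∈ IsLocalRing.maximalIdeal _ ^ 2 :=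
  mem_sq_of_not_isAbsContactIdealAt (((S.biWild_iff n).mp h j ν hs).2) hf h1

/-- (same for the hugged hypersurface: no member of `(g_j)` is a regular parameter — `ν ≥ 2` read
operator-free). [folklore] -/
theorem BiWild.germ_mem_sq {S : HugShadow T} {n : ℕ} (h : S.BiWild n) {j ν : ℕ} (hs : S.StableFrom j ν)
    {f : (T.St (S.m + j)).presheaf.stalk (T.pt (S.m + j))} (hf : f ∈ stalkIdeal (strictIter T S.m S.germ j) (T.pt (S.m + j)))
    (h1 : f ∈ IsLocalRing.maximalIdeal _) : f ∈ IsLocalRing.maximalIdeal _ ^ 2 :=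
  mem_sq_of_not_isAbsContactIdealAt (((S.biWild_iff n).mp h j ν hs).1) hf h1

/-- **CO-PURE ⇒ TAIL-TAME (PROVED shape of the cofactor-contact law)**: at a stable stage with `ν + 1 = n`, a member of
the cofactor of order exactly one is a tail contact witness. [folklore] -/
theorem tailTameAt_of_linear_member {n j ν : ℕ} {f : (T.St (S.m + j)).presheaf.stalk (T.pt (S.m + j))}
    (hf : f ∈ S.cofactorIdeal j) (h1 : f ∈ IsLocalRing.maximalIdeal _) (h2 : f ∉ IsLocalRing.maximalIdeal _ ^ 2) :
    S.TailTameAt n j ν :=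
  isAbsContactIdealAt_of_mem (n - ν) hf h1 h2

end HugShadow

/-! ## §19 (g17 · NEW) The cells: g16's located residual (L,P,drift) cut by factor tameness; the TAME SLAB of the whole
impure principal column -/

/-- **CELL (L,P,drift,tame) · DECIDED-MOD-PORT (`FactorContactPort`, paper proof (T1)–(T5); `tameDrifting_of_port`) —
EMPTY**: in-locus singular-class towers with an impure principal DRIFTING shadow one of whose two factors has an
absolute contact witness at some stable stage: the tower then hugs the REGULAR surface germ cut out by the witness,
contradicting the class.  Contains every CO-PURE drifting tower (`n = ν + 1`, cofactor of order one) and, over a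
perfect field, every drifting tower with `p ∤ ν` or `p ∤ n − ν` ((R1)) — in particular ALL drifting chains
of the census
beds T-IT / T-IZ2 (weight `n = 3`: `ν = 2`, `n − ν = 1`). -/
def TameDriftingTowersTerminate (n : ℕ) : Prop :=
  NoTower n fun T => SingularClass T ∧ InLocusShadow T ∧
    ∃ S : HugShadow T, S.Principal ∧ ¬ S.Pure n ∧ S.Drifting n ∧ S.FactorTame n

/-- **CELL (L,P,drift,wild) = THE LOCATED RESIDUAL of this generation · UNDECIDED · IDEA-NEEDED · INSTRUMENTABLE
(I-BW)**: in-locus singular-class towers with an impure principal drifting shadow that is BI-WILD — at every stable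
stage neither the hugged hypersurface `(g_j, ν)` nor the cofactor `(J_j, n − ν)` admits a regular hypersurface of
maximal contact, even for absolute operators (normal form (N′): `ν ≥ 2`, `n − ν ≥ 2`, and at Hasse–Schmidt points
`p ∣ ν`, `p ∣ n − ν`, `n ≥ 2p`, both initial forms Frobenius forms; at the minimal weight `n = 2p` two
`p`-fold tangent
PLANE FIELDS `P_j ≠ Q_j` with `x_{j+1} = [P_j ∩ Q_j]`). -/
def WildDriftingTowersTerminate (n : ℕ) : Prop :=
  NoTower n fun T => SingularClass T ∧ InLocusShadow T ∧
    ∃ S : HugShadow T, S.Principal ∧ ¬ S.Pure n ∧ S.Drifting n ∧ S.BiWild n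

/-- **THE TAME SLAB of the impure principal column (isolated OR drifting) · DECIDED-MOD-PORT (`tameImpure_of_port`) —
EMPTY**: what the factor contact law removes from g16's (L,P,¬pure) column before any weight induction. -/
def TameImpureTowersTerminate (n : ℕ) : Prop :=
  NoTower n fun T => SingularClass T ∧ InLocusShadow T ∧
    ∃ S : HugShadow T, S.Principal ∧ ¬ S.Pure n ∧ S.FactorTame n

/-- the bi-wild slab of the impure principal column (display; = factor-isolated-wild ∪ drifting-wild). -/
def WildImpureTowersTerminate (n : ℕ) : Prop :=
  NoTower n fun T => SingularClass T ∧ InLocusShadow T ∧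
    ∃ S : HugShadow T, S.Principal ∧ ¬ S.Pure n ∧ S.BiWild n

/-! ## §20 (g17 · NEW) The factor contact port (COSTUME(cite): tree Giraud lemma over `ℤ` + order bound; paper proof
(T1)–(T5) in the module docstring; counted 0) -/

/-- **PORT `FactorContactPort n` — THE FACTOR CONTACT LAW (COSTUME(cite), paper proof (T1)–(T5): tree
`blowupAlgebra.colon_map_diffIdeal_le` = Giraud's lemma for `Diff^{≤ μ−1}` over ANY base ring, here `ℤ`, on the chart
`A[𝔪/u]`; tree `diffIdeal_le_of_le_pow_succ` = `ord ≥ μ ⇒ Diff^{≤ μ−1} ⊆ 𝔪`; g16 (D1)–(D3) for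
the orders and transforms
of the two factors; the strict transform of a regular hypersurface germ through the centre)**: along an in-locus
PRINCIPAL shadow of an infinite forced tower of weight `n`, stable from stage `j` at value `ν`, an absolute contact
witness for the hugged hypersurface `(𝓘(Σ_j), ν)` — or, on an IMPURE shadow, for the cofactor `(J_j, n − ν)` — is a
regular parameter `z` whose strict transforms `z^{(i)} = u_{i−1}^{-1} z^{(i−1)}` keep maximal contact with that factor
and therefore pass through EVERY later marked point: the tower hugs the REGULAR SURFACE germ `V(z) ∋ x_j`. -/
def FactorContactPort (n : ℕ) : Prop :=
  ∀ p : ℕ, p.Prime → ∀ (k : Type) [Field k] [CharP k p] (T : ForcedTower) (g : T.St 0 ⟶ Spec (.of k)),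
    IsBase (T.St 0) g → IsDatum n (T.D 0) → (T.D 0).boundary = [] →
      ∀ S : HugShadow T, S.InLocus → S.Principal → ∀ j ν : ℕ, S.StableFrom j ν →
        (S.TopTameAt j ν ∨ (¬ S.Pure n ∧ S.TailTameAt n j ν)) → RegularSurfaceHugging T

/-- the port over all weights. -/
def FactorContactPortAll : Prop := ∀ n : ℕ, 1 ≤ n → FactorContactPort n

/-! ## §22 (g17) The all-weights classes of the factor-tameness cut (wiring BY NAME in `MaxContactCutFactorContact`) -/

/-- The located residual (L,P,drift,wild) over all weights. -/
def NoWildDriftingTowers : Prop := ∀ n : ℕ, 1 ≤ n → WildDriftingTowersTerminate n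

/-- The decided cell over all weights (a CONSEQUENCE of the port: `noTameDriftingTowers_of_port`). -/
def NoTameDriftingTowers : Prop := ∀ n : ℕ, 1 ≤ n → TameDriftingTowersTerminate n

end Summit.ResolutionOfSingularities.ResolutionOfSingularities.Theorems.HugValuationCut
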